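import Literature.MathematicalPhysics.QuantumLattice.HubbardTTPrimeOpenBoxNumberAverage
import Literature.MathematicalPhysics.QuantumLattice.HubbardTTPrimeBoxHamiltonian
import HarnessLib

/-!
# Route `R2cOpenStripTangentLine` — the GRAND-CANONICAL (`μ`-shifted) TANGENT-LINE CONSUMER, part I (general form)
for the cruxes `RightFamilyBelowLine` (stmt-Ventures-19262) and `LeftFamilyBelowLine` (stmt-Ventures-19263)

HONEST FRAMING: first certified bounds; not a superconductivity verdict; every number certified or labelled float.
NO NUMBER IS CLAIMED HERE. Candidate written by the route pen (sr-mbsolver-var-7 g16), split in two files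
(≤ 400 lines each) by the filing prover: this file = §1–§3 (model-general consumer); the route's numbers
`(t,t',U) = (1,0,8)`, `μ = 8/5`, `ρ = 7/8`, `c = -18/25` and the embedding of the rev-3 exact-filling cruxes live in
`Theorems/R2cGcTangentConsumerLeaf.lean`. This file imports NO route (`Theses`) file: it is route-independent library material
for the `Theorems` side (theses-cone lint), importable by any consumer.

The rev-3 cruxes want certified SECTOR ground energies `E_open(a × kb; kN)` (definite particle number, a density
window on each side of `7/8`). The tangent line `ℓ(n) = -18/25 + (8/5)(n - 7/8) = -53/25 + (8/5)·n` of the leaf has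
the chemical potential `μ = 8/5` built in, so a certificate for the SHIFTED operator `H - (8/5)·N̂` below `-53/25`
per site needs NO definite filling. This file proves the consumer for that shape, for general `(t, t', U ≥ 0, μ, ρ, c)`:

* `line_mul_le_groundEnergy_openBox` — every sector `N ≤ 2ab` of the open `a × b` cluster lies above ANY supporting
  line of the convex `e = energyDensityTT' t t' U` at ANY density `ρ`: `ab·e(ρ) + s(N - ρ·ab) ≤ E_open(a × b; N)`
  (the `key` step of `energyDensityTT'_le_of_numberAverage_openBox`, isolated).
* `line_mul_le_re_dotProduct_openBox` — its VECTOR form for an ARBITRARY (number-indefinite) Fock vector `x`: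
  `ab·e(ρ)·‖x‖² + s(⟨x, N̂ x⟩ - ρ·ab·‖x‖²) ≤ Re⟨x, H_open x⟩` (sector decomposition
  `posSemidef_sub_sum_groundEnergy_smul_numberProj`, `Σ P_N = 1`, `Σ N·P_N = N̂`).
* `energyDensityTT'_le_of_gcFamily_right` / `_left` — the GRAND-CANONICAL ALL-`k` CONSUMER: a family (one finite
  vector mixture `ψ₁ … ψ_m` on each open `a × (k·b)` cluster, `k ≥ 1`) with `μ`-shifted energy
  `Σ_l Re⟨ψ_l, (H - μ N̂) ψ_l⟩ ≤ (kE + (k-1)Δ)·S` (`S = Σ_l ‖ψ_l‖² > 0`), k-free endpoint `E + Δ ≤ (c - μρ)·ab`, and a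
  ONE-SIDED affine bound on the mean particle number `(kM + (k-1)Γ)·S ≤ Σ_l ⟨ψ_l, N̂ ψ_l⟩` with `M + Γ ≥ ρ·ab` (RIGHT)
  resp. `Σ_l ⟨ψ_l, N̂ ψ_l⟩ ≤ (kM + (k-1)Γ)·S` with `M + Γ ≤ ρ·ab` (LEFT) forces `e(ρ) ≤ c` as soon as the supporting
  slope `s` at `ρ` satisfies `s ≥ μ` (RIGHT) resp. `s ≤ μ` (LEFT): summing the vector form over `l`,
  `k·ab·e(ρ) ≤ k·ab·c + (-Δ + (s - μ)Γ)` for every `k`, and `k → ∞`.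
* `energyDensityTT'_le_of_gcFamily_right_anyBox` / `_left_anyBox` (§3b, rev 3) — the same with the `k`-th member on
  ANY open box `a_k × b_k` with `a_k·b_k = k·ab` sites (e.g. the length-major `(k·b) × a`, whose Jordan–Wigner order
  keeps `a`-site columns contiguous — the shape column-MPS / strip producers write); only the site count is used.

Everything is PROVED from landed lemmas (Ruelle's sub-box variational principle and convexity in the density, as
typed in `HubbardTTPrimeOpenBoxNumberAverage.lean` / `HubbardTTPrimeBoxHamiltonian.lean`); no definition, no named
fact, no numerical input. Sources: Ruelle, *Statistical Mechanics* (1969) §2.4, §3.3–3.4 [Ruelle1969]; LeBlanc et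
al., Phys. Rev. X 5 (2015) 041041, eq. (1) [LeBlancEtAl2015].
-/

noncomputable section

open Matrix Finset
open scoped ComplexOrder BigOperators

namespace Summit.Ventures.CertifiedManyBodySolver.Theorems

open Literature.MathematicalPhysics.QuantumLattice
open Literature.MathematicalPhysics.QuantumLattice.ThermodynamicLimit

/-! ### §1 Every sector of an open box lies above a supporting line of `e` -/

/-- **Sectors above a supporting line.** If `e(ρ) + s(x - ρ) ≤ e(x)` on `[0,2)` (`e = energyDensityTT' t t' U`,
`U ≥ 0`), then for every open `a × b` box (`a, b ≥ 1`) and every filling `N ≤ 2ab`: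
`ab·e(ρ) + s(N - ρ·ab) ≤ E_open(a × b; N)` (proper sectors by `energyDensityTT'_le_openBox`, the filled band by
`groundEnergy_hamiltonian_add_full` + `supporting_line_energyDensityTT'_at_two_le`). Ruelle (1969) §3.3–3.4.
[cite: Ruelle1969, §3.4] -/
theorem line_mul_le_groundEnergy_openBox (t t' : ℝ) {U : ℝ} (hU : 0 ≤ U) {a b : ℕ} (ha : 1 ≤ a) (hb : 1 ≤ b)
    {ρ s : ℝ}
    (hs : ∀ x ∈ Set.Ico (0 : ℝ) 2, energyDensityTT' t t' U ρ + s * (x - ρ) ≤ energyDensityTT' t t' U x)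
    {N : ℕ} (hN : N ≤ 2 * (a * b)) :
    (a : ℝ) * (b : ℝ) * energyDensityTT' t t' U ρ + s * ((N : ℝ) - ρ * ((a : ℝ) * (b : ℝ))) ≤
      groundEnergy (hubbardOpenBoxTT' a b t t' U) N := by
  have hs2 := supporting_line_energyDensityTT'_at_two_le t t' hU hs
  have hABpos : (0 : ℝ) < (a : ℝ) * (b : ℝ) := by exact_mod_cast Nat.mul_pos ha hb
  rcases hN.lt_or_eq with hlt | rfl
  · -- a proper sector: the open-box consumer and the supporting line at `x = N/(ab)`
    have hx : (N : ℝ) / ((a : ℝ) * (b : ℝ)) ∈ Set.Ico (0 : ℝ) 2 := by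
      refine ⟨by positivity, ?_⟩
      rw [div_lt_iff₀ hABpos]
      have : (N : ℝ) < ((2 * (a * b) : ℕ) : ℝ) := by exact_mod_cast hlt
      push_cast at this
      linarith
    have h1 := hs _ hx
    have h2 := energyDensityTT'_le_openBox t t' hU ha hb hlt
    rw [le_div_iff₀ hABpos] at h2
    have h3 : s * ((N : ℝ) / ((a : ℝ) * (b : ℝ)) - ρ) * ((a : ℝ) * (b : ℝ)) =
        s * ((N : ℝ) - ρ * ((a : ℝ) * (b : ℝ))) := by
      field_simp
    nlinarith [mul_le_mul_of_nonneg_right h1 hABpos.le]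
  · -- the filled band `E_open(2ab) = U·ab`
    have hfull : groundEnergy (hubbardOpenBoxTT' a b t t' U) (2 * (a * b)) = U * ((a : ℝ) * (b : ℝ)) := by
      rw [hubbardOpenBoxTT', ← card_rectSites a b, groundEnergy_hamiltonian_add_full, card_rectSites]
      push_cast; ring
    rw [hfull]
    push_cast
    nlinarith [mul_le_mul_of_nonneg_right hs2 hABpos.le]

/-! ### §2 The vector form: number-indefinite states of an open box -/

section SectorSums

variable {Λ : Type*} [LinearOrder Λ] [Fintype Λ]

/-- `Σ_{N ≤ 2|Λ|} ⟨x, P_N x⟩ = ⟨x, x⟩` (real parts): the number distribution of a Fock vector has total mass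
`‖x‖²`. [folklore] -/
theorem sum_range_re_dotProduct_numberProj_mulVec (x : Fock (Orb Λ)) :
    ∑ N ∈ range (Fintype.card (Orb Λ) + 1), (star x ⬝ᵥ (numberProj N *ᵥ x)).re = (star x ⬝ᵥ x).re := by
  classical
  rw [← Complex.re_sum, ← dotProduct_sum, sum_numberProj_mulVec]

/-- `Σ_{N ≤ 2|Λ|} N·⟨x, P_N x⟩ = ⟨x, N̂ x⟩` (real parts): the mean of the number distribution is the expected
particle number. [folklore] -/
theorem sum_range_natCast_mul_re_dotProduct_numberProj_mulVec (x : Fock (Orb Λ)) :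
    ∑ N ∈ range (Fintype.card (Orb Λ) + 1), (N : ℝ) * (star x ⬝ᵥ (numberProj N *ᵥ x)).re =
      (star x ⬝ᵥ (totalNumber *ᵥ x)).re := by
  classical
  rw [← sum_range_smul_numberProj_eq_totalNumber, Matrix.sum_mulVec, dotProduct_sum, Complex.re_sum]
  refine Finset.sum_congr rfl fun N _ => ?_
  rw [smul_mulVec, dotProduct_smul, smul_eq_mul, ← Complex.ofReal_natCast, Complex.re_ofReal_mul]

/-- `0 ≤ ⟨x, P_N x⟩` (real part). [folklore] -/
theorem re_dotProduct_numberProj_mulVec_nonneg (N : ℕ) (x : Fock (Orb Λ)) :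
    0 ≤ (star x ⬝ᵥ (numberProj N *ᵥ x)).re := by
  classical
  rw [dotProduct_numberProj_mulVec]
  exact (Complex.nonneg_iff.1 (dotProduct_star_self_nonneg _)).1

/-- **Sector decomposition of the energy of an arbitrary vector**: for a Hermitian number-conserving `H`,
`Σ_{N ≤ 2|Λ|} E_H(N)·⟨x, P_N x⟩ ≤ Re⟨x, H x⟩`. Ruelle (1969) §2.4. [cite: Ruelle1969, §2.4] -/
theorem sum_range_groundEnergy_mul_re_dotProduct_numberProj_le (H : Matrix (Finset (Orb Λ)) (Finset (Orb Λ)) ℂ)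
    (hH : H.IsHermitian) (hHN : Commute H totalNumber) (x : Fock (Orb Λ)) :
    ∑ N ∈ range (Fintype.card (Orb Λ) + 1), groundEnergy H N * (star x ⬝ᵥ (numberProj N *ᵥ x)).re ≤
      (star x ⬝ᵥ (H *ᵥ x)).re := by
  classical
  have h := (posSemidef_sub_sum_groundEnergy_smul_numberProj H hH hHN).dotProduct_mulVec_nonneg x
  obtain ⟨hre, -⟩ := Complex.nonneg_iff.mp h
  rw [sub_mulVec, dotProduct_sub, Matrix.sum_mulVec, dotProduct_sum, Complex.sub_re, Complex.re_sum,
    sub_nonneg] at hre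
  refine le_of_eq_of_le ?_ hre
  refine Finset.sum_congr rfl fun N _ => ?_
  rw [smul_mulVec, dotProduct_smul, smul_eq_mul, Complex.re_ofReal_mul]

end SectorSums

/-- **Vector form of the supporting-line bound.** For EVERY Fock vector `x` of the open `a × b` cluster
(no definite particle number needed): `ab·e(ρ)·‖x‖² + s(⟨x, N̂ x⟩ - ρ·ab·‖x‖²) ≤ Re⟨x, H_open x⟩` whenever
`e(ρ) + s(· - ρ)` supports `e = energyDensityTT' t t' U` on `[0,2)` (`U ≥ 0`). Ruelle (1969) §2.4 + §3.4.
[cite: Ruelle1969, §3.4] -/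
theorem line_mul_le_re_dotProduct_openBox (t t' : ℝ) {U : ℝ} (hU : 0 ≤ U) {a b : ℕ} (ha : 1 ≤ a) (hb : 1 ≤ b)
    {ρ s : ℝ}
    (hs : ∀ x ∈ Set.Ico (0 : ℝ) 2, energyDensityTT' t t' U ρ + s * (x - ρ) ≤ energyDensityTT' t t' U x)
    (x : Fock (Orb (Fin a ×ₗ Fin b))) :
    (a : ℝ) * (b : ℝ) * energyDensityTT' t t' U ρ * (star x ⬝ᵥ x).re +
        s * ((star x ⬝ᵥ (totalNumber *ᵥ x)).re - ρ * ((a : ℝ) * (b : ℝ)) * (star x ⬝ᵥ x).re) ≤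
      (star x ⬝ᵥ (hubbardOpenBoxTT' a b t t' U *ᵥ x)).re := by
  classical
  have hE := sum_range_groundEnergy_mul_re_dotProduct_numberProj_le (hubbardOpenBoxTT' a b t t' U)
    (hubbardOpenBoxTT'_isHermitian a b t t' U) (hubbardOpenBoxTT'_commute_totalNumber a b t t' U) x
  have hcard : Fintype.card (Orb (Fin a ×ₗ Fin b)) = 2 * (a * b) := by rw [card_orb, card_rectSites]
  -- every sector above the line, weighted by the number distribution of `x`
  have hle : ∑ N ∈ range (Fintype.card (Orb (Fin a ×ₗ Fin b)) + 1),
      ((a : ℝ) * (b : ℝ) * energyDensityTT' t t' U ρ + s * ((N : ℝ) - ρ * ((a : ℝ) * (b : ℝ)))) *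
        (star x ⬝ᵥ (numberProj N *ᵥ x)).re ≤
      ∑ N ∈ range (Fintype.card (Orb (Fin a ×ₗ Fin b)) + 1),
        groundEnergy (hubbardOpenBoxTT' a b t t' U) N * (star x ⬝ᵥ (numberProj N *ᵥ x)).re := by
    refine Finset.sum_le_sum fun N hN => mul_le_mul_of_nonneg_right ?_ (re_dotProduct_numberProj_mulVec_nonneg N x)
    have hN' : N ≤ 2 * (a * b) := by rw [← hcard]; exact Nat.lt_succ_iff.1 (mem_range.1 hN)
    exact line_mul_le_groundEnergy_openBox t t' hU ha hb hs hN'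
  -- collapse the affine terms
  have hsum : ∑ N ∈ range (Fintype.card (Orb (Fin a ×ₗ Fin b)) + 1),
      ((a : ℝ) * (b : ℝ) * energyDensityTT' t t' U ρ + s * ((N : ℝ) - ρ * ((a : ℝ) * (b : ℝ)))) *
        (star x ⬝ᵥ (numberProj N *ᵥ x)).re =
      ((a : ℝ) * (b : ℝ) * energyDensityTT' t t' U ρ - s * (ρ * ((a : ℝ) * (b : ℝ)))) *
          ∑ N ∈ range (Fintype.card (Orb (Fin a ×ₗ Fin b)) + 1), (star x ⬝ᵥ (numberProj N *ᵥ x)).re +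
        s * ∑ N ∈ range (Fintype.card (Orb (Fin a ×ₗ Fin b)) + 1),
          (N : ℝ) * (star x ⬝ᵥ (numberProj N *ᵥ x)).re := by
    rw [Finset.mul_sum, Finset.mul_sum, ← Finset.sum_add_distrib]
    exact Finset.sum_congr rfl fun N _ => by ring
  rw [hsum, sum_range_re_dotProduct_numberProj_mulVec, sum_range_natCast_mul_re_dotProduct_numberProj_mulVec] at hle
  linarith

/-- The vector form SUMMED over a finite mixture `ψ₁ … ψ_m` of vectors of the open `a × b` cluster:
`ab·e(ρ)·S + s(Nψ - ρ·ab·S) ≤ Hψ` with `S = Σ‖ψ_l‖²`, `Nψ = Σ⟨ψ_l, N̂ ψ_l⟩`, `Hψ = Σ Re⟨ψ_l, H ψ_l⟩`.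
[cite: Ruelle1969, §3.4] -/
theorem line_mul_le_sum_re_dotProduct_openBox (t t' : ℝ) {U : ℝ} (hU : 0 ≤ U) {a b : ℕ} (ha : 1 ≤ a)
    (hb : 1 ≤ b) {ρ s : ℝ}
    (hs : ∀ x ∈ Set.Ico (0 : ℝ) 2, energyDensityTT' t t' U ρ + s * (x - ρ) ≤ energyDensityTT' t t' U x)
    {m : ℕ} (ψ : Fin m → Fock (Orb (Fin a ×ₗ Fin b))) :
    (a : ℝ) * (b : ℝ) * energyDensityTT' t t' U ρ * ∑ l, (star (ψ l) ⬝ᵥ ψ l).re +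
        s * (∑ l, (star (ψ l) ⬝ᵥ (totalNumber *ᵥ ψ l)).re -
          ρ * ((a : ℝ) * (b : ℝ)) * ∑ l, (star (ψ l) ⬝ᵥ ψ l).re) ≤
      ∑ l, (star (ψ l) ⬝ᵥ (hubbardOpenBoxTT' a b t t' U *ᵥ ψ l)).re := by
  have h := fun l => line_mul_le_re_dotProduct_openBox t t' hU ha hb hs (ψ l)
  have hle := Finset.sum_le_sum fun l (_ : l ∈ (Finset.univ : Finset (Fin m))) => h l
  rw [Finset.sum_add_distrib, ← Finset.mul_sum, ← Finset.mul_sum, Finset.sum_sub_distrib, ← Finset.mul_sum] at hle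
  exact hle

/-! ### §3 The grand-canonical all-`k` consumer -/

/-- From `k·w·e ≤ k·w·c + C` for every `k ≥ 1` (`w > 0`) conclude `e ≤ c`. [folklore] -/
theorem le_of_forall_nat_mul_le_add {e c C w : ℝ} (hw : 0 < w)
    (h : ∀ k : ℕ, 1 ≤ k → (k : ℝ) * w * e ≤ (k : ℝ) * w * c + C) : e ≤ c := by
  refine le_of_forall_pos_lt_add fun ε hε => ?_
  obtain ⟨k₀, hk₀⟩ := exists_nat_gt (C / (ε * w))
  have hεw : 0 < ε * w := mul_pos hε hw
  rw [div_lt_iff₀ hεw] at hk₀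
  have hk := h (k₀ + 1) (Nat.succ_le_succ (Nat.zero_le _))
  push_cast at hk
  by_contra hce
  rw [not_lt] at hce
  have hk' : ((k₀ : ℝ) + 1) * w * (c + ε) ≤ ((k₀ : ℝ) + 1) * w * e :=
    mul_le_mul_of_nonneg_left hce (by positivity)
  nlinarith

/-- **Grand-canonical all-`k` consumer, RIGHT half.** Let `U ≥ 0`, `e = energyDensityTT' t t' U`, `e(ρ) + s(x - ρ) ≤ e(x)`
on `[0,2)` with `μ ≤ s`. Suppose an open box `a × b` (`a, b ≥ 1`) and reals `E, Δ, M, Γ` with `E + Δ ≤ (c - μρ)·ab`,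
`ρ·ab ≤ M + Γ`, and for every `k ≥ 1` a finite family `ψ : Fin m → Fock` on the open `a × (k·b)` cluster with
`S = Σ‖ψ_l‖² > 0`, `Σ Re⟨ψ_l, H ψ_l⟩ - μ Σ⟨ψ_l, N̂ ψ_l⟩ ≤ (kE + (k-1)Δ)·S` and `(kM + (k-1)Γ)·S ≤ Σ⟨ψ_l, N̂ ψ_l⟩`. Then
`e(ρ) ≤ c`. (Per `k`: `k·ab·e(ρ) ≤ k·ab·c - Δ + (s - μ)Γ`.) Ruelle (1969) §3.3–3.4 for the model of LeBlanc et al.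
(2015) eq. (1). [cite: Ruelle1969, §3.4] -/
theorem energyDensityTT'_le_of_gcFamily_right (t t' : ℝ) {U : ℝ} (hU : 0 ≤ U) {ρ : ℝ} (μ c : ℝ) {s : ℝ}
    (hμs : μ ≤ s)
    (hs : ∀ x ∈ Set.Ico (0 : ℝ) 2, energyDensityTT' t t' U ρ + s * (x - ρ) ≤ energyDensityTT' t t' U x)
    {a b : ℕ} (ha : 1 ≤ a) (hb : 1 ≤ b) {E Δ M Γ : ℝ} (hE : E + Δ ≤ (c - μ * ρ) * ((a : ℝ) * (b : ℝ)))
    (hM : ρ * ((a : ℝ) * (b : ℝ)) ≤ M + Γ)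
    (hfam : ∀ k : ℕ, 1 ≤ k → ∃ m : ℕ, ∃ ψ : Fin m → Fock (Orb (Fin a ×ₗ Fin (k * b))),
      0 < ∑ l, (star (ψ l) ⬝ᵥ ψ l).re ∧
      ∑ l, (star (ψ l) ⬝ᵥ (hubbardOpenBoxTT' a (k * b) t t' U *ᵥ ψ l)).re
          - μ * ∑ l, (star (ψ l) ⬝ᵥ (totalNumber *ᵥ ψ l)).re
        ≤ ((k : ℝ) * E + ((k : ℝ) - 1) * Δ) * ∑ l, (star (ψ l) ⬝ᵥ ψ l).re ∧
      ((k : ℝ) * M + ((k : ℝ) - 1) * Γ) * ∑ l, (star (ψ l) ⬝ᵥ ψ l).re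
        ≤ ∑ l, (star (ψ l) ⬝ᵥ (totalNumber *ᵥ ψ l)).re) :
    energyDensityTT' t t' U ρ ≤ c := by
  have hABpos : (0 : ℝ) < (a : ℝ) * (b : ℝ) := by exact_mod_cast Nat.mul_pos ha hb
  refine le_of_forall_nat_mul_le_add (C := -Δ + (s - μ) * Γ) hABpos fun k hk => ?_
  obtain ⟨m, ψ, hS, hH, hN⟩ := hfam k hk
  have hkb : 1 ≤ k * b := Nat.mul_pos hk hb
  have hsum := line_mul_le_sum_re_dotProduct_openBox t t' hU ha hkb hs ψ
  push_cast at hsum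
  set S := ∑ l, (star (ψ l) ⬝ᵥ ψ l).re with hSdef
  set Nψ := ∑ l, (star (ψ l) ⬝ᵥ (totalNumber *ᵥ ψ l)).re with hNψ
  set Hψ := ∑ l, (star (ψ l) ⬝ᵥ (hubbardOpenBoxTT' a (k * b) t t' U *ᵥ ψ l)).re with hHψ
  have hk0 : (0 : ℝ) ≤ (k : ℝ) := Nat.cast_nonneg k
  have h3 : (s - μ) * (((k : ℝ) * M + ((k : ℝ) - 1) * Γ) * S) ≤ (s - μ) * Nψ :=
    mul_le_mul_of_nonneg_left hN (sub_nonneg.2 hμs)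
  have h4 : (k : ℝ) * S * (E + Δ) ≤ (k : ℝ) * S * ((c - μ * ρ) * ((a : ℝ) * (b : ℝ))) :=
    mul_le_mul_of_nonneg_left hE (mul_nonneg hk0 hS.le)
  have h5 : (k : ℝ) * (s - μ) * S * (ρ * ((a : ℝ) * (b : ℝ))) ≤ (k : ℝ) * (s - μ) * S * (M + Γ) :=
    mul_le_mul_of_nonneg_left hM (mul_nonneg (mul_nonneg hk0 (sub_nonneg.2 hμs)) hS.le)
  have hmain : (k : ℝ) * ((a : ℝ) * (b : ℝ)) * energyDensityTT' t t' U ρ * S ≤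
      ((k : ℝ) * ((a : ℝ) * (b : ℝ)) * c + (-Δ + (s - μ) * Γ)) * S := by
    linarith
  exact le_of_mul_le_mul_right hmain hS

/-- **Grand-canonical all-`k` consumer, LEFT half**: the same with `s ≤ μ`, `M + Γ ≤ ρ·ab` and the mean particle
number bounded ABOVE, `Σ⟨ψ_l, N̂ ψ_l⟩ ≤ (kM + (k-1)Γ)·S`. [cite: Ruelle1969, §3.4] -/
theorem energyDensityTT'_le_of_gcFamily_left (t t' : ℝ) {U : ℝ} (hU : 0 ≤ U) {ρ : ℝ} (μ c : ℝ) {s : ℝ}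
    (hsμ : s ≤ μ)
    (hs : ∀ x ∈ Set.Ico (0 : ℝ) 2, energyDensityTT' t t' U ρ + s * (x - ρ) ≤ energyDensityTT' t t' U x)
    {a b : ℕ} (ha : 1 ≤ a) (hb : 1 ≤ b) {E Δ M Γ : ℝ} (hE : E + Δ ≤ (c - μ * ρ) * ((a : ℝ) * (b : ℝ)))
    (hM : M + Γ ≤ ρ * ((a : ℝ) * (b : ℝ)))
    (hfam : ∀ k : ℕ, 1 ≤ k → ∃ m : ℕ, ∃ ψ : Fin m → Fock (Orb (Fin a ×ₗ Fin (k * b))),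
      0 < ∑ l, (star (ψ l) ⬝ᵥ ψ l).re ∧
      ∑ l, (star (ψ l) ⬝ᵥ (hubbardOpenBoxTT' a (k * b) t t' U *ᵥ ψ l)).re
          - μ * ∑ l, (star (ψ l) ⬝ᵥ (totalNumber *ᵥ ψ l)).re
        ≤ ((k : ℝ) * E + ((k : ℝ) - 1) * Δ) * ∑ l, (star (ψ l) ⬝ᵥ ψ l).re ∧
      ∑ l, (star (ψ l) ⬝ᵥ (totalNumber *ᵥ ψ l)).re
        ≤ ((k : ℝ) * M + ((k : ℝ) - 1) * Γ) * ∑ l, (star (ψ l) ⬝ᵥ ψ l).re) :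
    energyDensityTT' t t' U ρ ≤ c := by
  have hABpos : (0 : ℝ) < (a : ℝ) * (b : ℝ) := by exact_mod_cast Nat.mul_pos ha hb
  refine le_of_forall_nat_mul_le_add (C := -Δ + (s - μ) * Γ) hABpos fun k hk => ?_
  obtain ⟨m, ψ, hS, hH, hN⟩ := hfam k hk
  have hkb : 1 ≤ k * b := Nat.mul_pos hk hb
  have hsum := line_mul_le_sum_re_dotProduct_openBox t t' hU ha hkb hs ψ
  push_cast at hsum
  set S := ∑ l, (star (ψ l) ⬝ᵥ ψ l).re with hSdef
  set Nψ := ∑ l, (star (ψ l) ⬝ᵥ (totalNumber *ᵥ ψ l)).re with hNψ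
  set Hψ := ∑ l, (star (ψ l) ⬝ᵥ (hubbardOpenBoxTT' a (k * b) t t' U *ᵥ ψ l)).re with hHψ
  have hk0 : (0 : ℝ) ≤ (k : ℝ) := Nat.cast_nonneg k
  have h3 : (μ - s) * Nψ ≤ (μ - s) * (((k : ℝ) * M + ((k : ℝ) - 1) * Γ) * S) :=
    mul_le_mul_of_nonneg_left hN (sub_nonneg.2 hsμ)
  have h4 : (k : ℝ) * S * (E + Δ) ≤ (k : ℝ) * S * ((c - μ * ρ) * ((a : ℝ) * (b : ℝ))) :=
    mul_le_mul_of_nonneg_left hE (mul_nonneg hk0 hS.le)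
  have h5 : (k : ℝ) * (μ - s) * S * (M + Γ) ≤ (k : ℝ) * (μ - s) * S * (ρ * ((a : ℝ) * (b : ℝ))) :=
    mul_le_mul_of_nonneg_left hM (mul_nonneg (mul_nonneg hk0 (sub_nonneg.2 hsμ)) hS.le)
  have hmain : (k : ℝ) * ((a : ℝ) * (b : ℝ)) * energyDensityTT' t t' U ρ * S ≤
      ((k : ℝ) * ((a : ℝ) * (b : ℝ)) * c + (-Δ + (s - μ) * Γ)) * S := by
    linarith
  exact le_of_mul_le_mul_right hmain hS

/-! ### §3b The grand-canonical all-`k` consumer on boxes of ANY shape with `k·ab` sites -/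

/-- **Grand-canonical all-`k` consumer, RIGHT half, boxes of any shape.** As
`energyDensityTT'_le_of_gcFamily_right`, but the `k`-th member of the family may live on ANY open box `a_k × b_k` with
`a_k · b_k = k · (a · b)` sites (`a × (k·b)`, `(k·b) × a` — the length-major box whose Jordan–Wigner order keeps the
`a`-site columns contiguous —, `(k·a) × b`, …): the proof only uses the site count. Ruelle (1969) §3.3–3.4.
[cite: Ruelle1969, §3.4] -/
theorem energyDensityTT'_le_of_gcFamily_right_anyBox (t t' : ℝ) {U : ℝ} (hU : 0 ≤ U) {ρ : ℝ} (μ c : ℝ) {s : ℝ}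
    (hμs : μ ≤ s)
    (hs : ∀ x ∈ Set.Ico (0 : ℝ) 2, energyDensityTT' t t' U ρ + s * (x - ρ) ≤ energyDensityTT' t t' U x)
    {a b : ℕ} (ha : 1 ≤ a) (hb : 1 ≤ b) {E Δ M Γ : ℝ} (hE : E + Δ ≤ (c - μ * ρ) * ((a : ℝ) * (b : ℝ)))
    (hM : ρ * ((a : ℝ) * (b : ℝ)) ≤ M + Γ)
    (hfam : ∀ k : ℕ, 1 ≤ k → ∃ a' b' : ℕ, 1 ≤ a' ∧ 1 ≤ b' ∧ a' * b' = k * (a * b) ∧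
      ∃ m : ℕ, ∃ ψ : Fin m → Fock (Orb (Fin a' ×ₗ Fin b')),
      0 < ∑ l, (star (ψ l) ⬝ᵥ ψ l).re ∧
      ∑ l, (star (ψ l) ⬝ᵥ (hubbardOpenBoxTT' a' b' t t' U *ᵥ ψ l)).re
          - μ * ∑ l, (star (ψ l) ⬝ᵥ (totalNumber *ᵥ ψ l)).re
        ≤ ((k : ℝ) * E + ((k : ℝ) - 1) * Δ) * ∑ l, (star (ψ l) ⬝ᵥ ψ l).re ∧
      ((k : ℝ) * M + ((k : ℝ) - 1) * Γ) * ∑ l, (star (ψ l) ⬝ᵥ ψ l).re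
        ≤ ∑ l, (star (ψ l) ⬝ᵥ (totalNumber *ᵥ ψ l)).re) :
    energyDensityTT' t t' U ρ ≤ c := by
  have hABpos : (0 : ℝ) < (a : ℝ) * (b : ℝ) := by exact_mod_cast Nat.mul_pos ha hb
  refine le_of_forall_nat_mul_le_add (C := -Δ + (s - μ) * Γ) hABpos fun k hk => ?_
  obtain ⟨a', b', ha', hb', hcount, m, ψ, hS, hH, hN⟩ := hfam k hk
  have hsum := line_mul_le_sum_re_dotProduct_openBox t t' hU ha' hb' hs ψ
  have hcount' : (a' : ℝ) * (b' : ℝ) = (k : ℝ) * ((a : ℝ) * (b : ℝ)) := by exact_mod_cast hcount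
  rw [hcount'] at hsum
  set S := ∑ l, (star (ψ l) ⬝ᵥ ψ l).re with hSdef
  set Nψ := ∑ l, (star (ψ l) ⬝ᵥ (totalNumber *ᵥ ψ l)).re with hNψ
  set Hψ := ∑ l, (star (ψ l) ⬝ᵥ (hubbardOpenBoxTT' a' b' t t' U *ᵥ ψ l)).re with hHψ
  have hk0 : (0 : ℝ) ≤ (k : ℝ) := Nat.cast_nonneg k
  have h3 : (s - μ) * (((k : ℝ) * M + ((k : ℝ) - 1) * Γ) * S) ≤ (s - μ) * Nψ :=
    mul_le_mul_of_nonneg_left hN (sub_nonneg.2 hμs)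
  have h4 : (k : ℝ) * S * (E + Δ) ≤ (k : ℝ) * S * ((c - μ * ρ) * ((a : ℝ) * (b : ℝ))) :=
    mul_le_mul_of_nonneg_left hE (mul_nonneg hk0 hS.le)
  have h5 : (k : ℝ) * (s - μ) * S * (ρ * ((a : ℝ) * (b : ℝ))) ≤ (k : ℝ) * (s - μ) * S * (M + Γ) :=
    mul_le_mul_of_nonneg_left hM (mul_nonneg (mul_nonneg hk0 (sub_nonneg.2 hμs)) hS.le)
  have hmain : (k : ℝ) * ((a : ℝ) * (b : ℝ)) * energyDensityTT' t t' U ρ * S ≤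
      ((k : ℝ) * ((a : ℝ) * (b : ℝ)) * c + (-Δ + (s - μ) * Γ)) * S := by
    linarith
  exact le_of_mul_le_mul_right hmain hS

/-- **Grand-canonical all-`k` consumer, LEFT half, boxes of any shape** (`a_k · b_k = k · ab` sites; `s ≤ μ`,
`M + Γ ≤ ρ·ab`, mean particle number bounded ABOVE). [cite: Ruelle1969, §3.4] -/
theorem energyDensityTT'_le_of_gcFamily_left_anyBox (t t' : ℝ) {U : ℝ} (hU : 0 ≤ U) {ρ : ℝ} (μ c : ℝ) {s : ℝ}
    (hsμ : s ≤ μ)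
    (hs : ∀ x ∈ Set.Ico (0 : ℝ) 2, energyDensityTT' t t' U ρ + s * (x - ρ) ≤ energyDensityTT' t t' U x)
    {a b : ℕ} (ha : 1 ≤ a) (hb : 1 ≤ b) {E Δ M Γ : ℝ} (hE : E + Δ ≤ (c - μ * ρ) * ((a : ℝ) * (b : ℝ)))
    (hM : M + Γ ≤ ρ * ((a : ℝ) * (b : ℝ)))
    (hfam : ∀ k : ℕ, 1 ≤ k → ∃ a' b' : ℕ, 1 ≤ a' ∧ 1 ≤ b' ∧ a' * b' = k * (a * b) ∧
      ∃ m : ℕ, ∃ ψ : Fin m → Fock (Orb (Fin a' ×ₗ Fin b')),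
      0 < ∑ l, (star (ψ l) ⬝ᵥ ψ l).re ∧
      ∑ l, (star (ψ l) ⬝ᵥ (hubbardOpenBoxTT' a' b' t t' U *ᵥ ψ l)).re
          - μ * ∑ l, (star (ψ l) ⬝ᵥ (totalNumber *ᵥ ψ l)).re
        ≤ ((k : ℝ) * E + ((k : ℝ) - 1) * Δ) * ∑ l, (star (ψ l) ⬝ᵥ ψ l).re ∧
      ∑ l, (star (ψ l) ⬝ᵥ (totalNumber *ᵥ ψ l)).re
        ≤ ((k : ℝ) * M + ((k : ℝ) - 1) * Γ) * ∑ l, (star (ψ l) ⬝ᵥ ψ l).re) :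
    energyDensityTT' t t' U ρ ≤ c := by
  have hABpos : (0 : ℝ) < (a : ℝ) * (b : ℝ) := by exact_mod_cast Nat.mul_pos ha hb
  refine le_of_forall_nat_mul_le_add (C := -Δ + (s - μ) * Γ) hABpos fun k hk => ?_
  obtain ⟨a', b', ha', hb', hcount, m, ψ, hS, hH, hN⟩ := hfam k hk
  have hsum := line_mul_le_sum_re_dotProduct_openBox t t' hU ha' hb' hs ψ
  have hcount' : (a' : ℝ) * (b' : ℝ) = (k : ℝ) * ((a : ℝ) * (b : ℝ)) := by exact_mod_cast hcount
  rw [hcount'] at hsum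
  set S := ∑ l, (star (ψ l) ⬝ᵥ ψ l).re with hSdef
  set Nψ := ∑ l, (star (ψ l) ⬝ᵥ (totalNumber *ᵥ ψ l)).re with hNψ
  set Hψ := ∑ l, (star (ψ l) ⬝ᵥ (hubbardOpenBoxTT' a' b' t t' U *ᵥ ψ l)).re with hHψ
  have hk0 : (0 : ℝ) ≤ (k : ℝ) := Nat.cast_nonneg k
  have h3 : (μ - s) * Nψ ≤ (μ - s) * (((k : ℝ) * M + ((k : ℝ) - 1) * Γ) * S) :=
    mul_le_mul_of_nonneg_left hN (sub_nonneg.2 hsμ)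
  have h4 : (k : ℝ) * S * (E + Δ) ≤ (k : ℝ) * S * ((c - μ * ρ) * ((a : ℝ) * (b : ℝ))) :=
    mul_le_mul_of_nonneg_left hE (mul_nonneg hk0 hS.le)
  have h5 : (k : ℝ) * (μ - s) * S * (M + Γ) ≤ (k : ℝ) * (μ - s) * S * (ρ * ((a : ℝ) * (b : ℝ))) :=
    mul_le_mul_of_nonneg_left hM (mul_nonneg (mul_nonneg hk0 (sub_nonneg.2 hsμ)) hS.le)
  have hmain : (k : ℝ) * ((a : ℝ) * (b : ℝ)) * energyDensityTT' t t' U ρ * S ≤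
      ((k : ℝ) * ((a : ℝ) * (b : ℝ)) * c + (-Δ + (s - μ) * Γ)) * S := by
    linarith
  exact le_of_mul_le_mul_right hmain hS

end Summit.Ventures.CertifiedManyBodySolver.Theorems

end
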